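import Mathlib.Analysis.InnerProductSpace.LinearPMap
import Mathlib.MeasureTheory.Function.LpSpace.ContinuousFunctions
import Mathlib.Analysis.Fourier.AddCircleMulti
import Mathlib.Analysis.InnerProductSpace.Projection.Basic
import Literature.Analysis.FluidPDE.LerayProjector
import Literature.Analysis.FunctionSpaces.Complexify
import Literature.Analysis.FunctionSpaces.FlatTorus
import Literature.Analysis.FunctionSpaces.TorusCalculus
import Literature.Analysis.FunctionSpaces.TorusSobolevNorm
import Literature.Analysis.FunctionSpaces.TorusSobolevSpace
import Literature.Analysis.UnboundedOperators.SymmetricPMap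
import Literature.Analysis.UnboundedOperators.DiagonalOperator
import HarnessLib

-- D-0014 sorry-sweep (operator, 2026-08-13): sorried theorems -> named facts `def X : Prop`; partial proofs preserved in comments
-- provenance: harness21/H21/H21/Prelude/FluidKinetic/StokesTorus.lean @ 6cce177 (interim HEAD d8f2665); M5 mechanical rewrite
/-!
# The Stokes operator on the flat torus `T^d` and its Galerkin truncations

Trunk: FluidKinetic (outline `H21/Outlines/FluidKinetic.md`, item F7 `StokesTorus`; notion
`stokes_operator_torus`).

On the flat torus there is no boundary, so the Stokes operator `A = -P Δ` on the mean-zero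
solenoidal energy space `H = Torus.energySpace d ⊂ L²(T^d; ℝ^d)` is simply `-Δ` restricted to
solenoidal fields: `D(A) = H ∩ H²(T^d)`, `A v = -Δ v`, a positive self-adjoint operator with
compact resolvent, eigenfunctions `a cos(2π k·x)`, `a sin(2π k·x)` (`k ∈ ℤ^d ∖ {0}`, `a ⊥ k`) and
eigenvalues `4π²|k|²` (Constantin–Foias 1988, Ch. 4, (4.11)–(4.14); Temam 1977, Ch. I §2.6).
The finite-dimensional spans of the first eigenfunctions and the orthogonal projections `P_N`
onto them are the Galerkin truncations used to construct weak solutions.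

## Contents

* `Torus.IsStokesImage v w` — the weak relation `w = -Δ v` tested against smooth solenoidal
  mean-zero fields; `Torus.stokesGraph d` — the graph `{(v, -Δ v)} ⊂ H × H` as a submodule;
  `Torus.stokesOperator d : L² →ₗ.[ℝ] L²` — the Stokes operator, Mathlib's
  `Submodule.toLinearPMap` of this graph; `Torus.stokesGraphH d`, `Torus.stokesOperatorH d :
  H →ₗ.[ℝ] H` — the same operator viewed *in the Hilbert space `H`* (the version that is
  self-adjoint); `Torus.stokesEigenvalue k = 4π²|k|²`.
* `Torus.stokesMode k a c`, `Torus.stokesModeL2 k a c` — the real eigenfields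
  `a cos(2π k·x)` (`c = true`) / `a sin(2π k·x)` (`c = false`) as continuous maps and as `L²`
  classes; `Torus.galerkinIndex N`, `Torus.projPerp k i`, `Torus.galerkinFamily N`,
  `Torus.galerkinSpace N`, `Torus.galerkinProj N` — the Galerkin spaces `span {modes, |k| ≤ N}`
  and the orthogonal projections `P_N` onto them.
* API (sorried unless noted): `stokesGraph_fst_eq_zero_imp` (real proof: the graph is
  functional), `stokesOperator_domain_eq`, `mem_domain_stokesOperator_iff`,
  `mem_domain_stokesOperatorH_iff`, `coe_stokesOperatorH_apply` (real proofs: the two versions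
  agree), `isSelfAdjoint_stokesOperatorH`, `isPositive_stokesOperator`,
  `hasEigenvector_stokesOperator_stokesModeL2`, `stokesOperatorH_eq_diagonalPMap` (bridge to the
  UnbddOp trunk: a genuine equality of `LinearPMap`s on `H`) and its `L²` corollary
  `stokesOperator_eq_diagonalPMap`, `galerkinSpace_le_energySpace`, `finrank_galerkinSpace`,
  `galerkinProj_comp_lerayProjector`, `stokesOperator_galerkinProj` (`A P_N = P_N A` on `D(A)`,
  the outline's `galerkinProj_commute_stokes`), `tendsto_galerkinProj`,
  `topologicalClosure_iSup_galerkinSpace` (the outline's `dense_iSup_galerkinSpace`, stated as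
  a closure equality in `L²` since density is relative to `H`).

## Mathlib search

Mathlib (this pin) has partially defined linear operators `LinearPMap` with
`Submodule.toLinearPMap` (an operator from a graph; hypothesis-free, but with junk value `0`
unless the graph is functional), their adjoints and `IsSelfAdjoint` (`LinearPMap.instStar`,
`Mathlib.Analysis.InnerProductSpace.LinearPMap`), `ContinuousMap.toLp`, the Fourier monomials
`UnitAddTorus.mFourier`, orthogonal projections `Submodule.starProjection`,
`FiniteDimensional.span_of_finite`, `FiniteDimensional.complete`, `Submodule.orthogonal_closure`.
It has no Stokes operator, no solenoidal spaces and no Galerkin truncation (grep `Stokes`,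
`Galerkin`, `solenoidal`: nothing). The eigenvalue and positivity vocabulary for `LinearPMap`
(`LinearPMap.IsPositive`, `LinearPMap.HasEigenvector`) and the diagonal operators
`HilbertBasis.diagonalPMap` / `HilbertBasis.diagonalDomain` are the accepted H21 UnbddOp prelude.

## Design notes

* Graph construction rather than `HilbertBasis.diagonalPMap` (review finding 9a). The
  UnbddOp trunk documents `HilbertBasis.diagonalPMap` as the intended carrier of the torus
  Stokes operator. Using it as the *definition* would require a `HilbertBasis ι ℝ
  (Torus.energySpace d)` made of the solenoidal Fourier modes, i.e. a proof that these modes are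
  complete in `H` — a Fourier-completeness theorem, which in this statement library is a
  (sorried) theorem, not something a definition may depend on. We therefore build the operator
  from its graph: `(v, w) ∈ stokesGraph d` iff `v, w ∈ H` and `w = -Δ v` weakly, i.e.
  `⟪w, g⟫ = -⟪v, Δ g⟫` for every smooth solenoidal mean-zero `g` (integration by parts twice,
  Constantin–Foias (4.12)); `stokesOperator d := (stokesGraph d).toLinearPMap`. The diagonal
  description is recovered as the theorem `stokesOperatorH_eq_diagonalPMap`: for *any* Hilbert
  basis of `H` consisting of Stokes modes with symbol `stokesEigenvalue`, the graph operator in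
  `H` equals `b.diagonalPMap m` (domains included).
* Two carriers, `L²` and `H` (review of attempt 1, finding 1). The outline's
  `stokesOperator d : L2T →ₗ.[ℝ] L2T` is convenient for the domain description, positivity,
  eigenvectors and the Galerkin statements, all of which live in `L²`. But self-adjointness of a
  `LinearPMap` on `L²` forces a dense domain in `L²` (Mathlib `IsSelfAdjoint.dense_domain`), while
  `D(A) ⊂ H ⊊ L²`; the literature's "`A` is self-adjoint" is a statement in the Hilbert space `H`.
  Hence `stokesOperatorH d : H →ₗ.[ℝ] H` (graph `stokesGraphH d`, the pull-back of `stokesGraph d`),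
  with `isSelfAdjoint_stokesOperatorH` and the bridge `stokesOperatorH_eq_diagonalPMap` stated on
  it, exactly as the UnbddOp trunk states `isSelfAdjoint_diagonalPMap` on the basis' ambient space.
  The two versions have the same domain and values (`mem_domain_stokesOperatorH_iff`,
  `coe_stokesOperatorH_apply`, proved). Downstream `Statements/NS/EnergySpaceTorus` should consume
  the `H`-version for self-adjointness.
* Mathlib's `Submodule.toLinearPMap g` returns the zero map when `g` is not functional; the lemma
  `stokesGraph_fst_eq_zero_imp` (`(0, w) ∈ stokesGraph d → w = 0`) is proved for real, so
  `stokesOperator d` is never in this junk branch (`Submodule.toLinearPMap_graph_eq` applies).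
* `IsStokesImage` is phrased with `L²` inner products against `L²` classes `φ, ψ` of `g, Δ g`
  (rather than with integrals of representatives), so that linearity of the graph in `(v, w)` is
  immediate from `inner_add_left` / `inner_smul_left`.
* The Galerkin family is indexed by the Fintype `↥(galerkinIndex N) × d × Bool`, so that
  `galerkinSpace N` is finite-dimensional by `FiniteDimensional.span_of_finite` and complete by
  `FiniteDimensional.complete`, whence `(galerkinSpace N).starProjection` needs no `sorry`. The
  family is redundant (`k` and `-k` give the same modes up to sign, and `projPerp k` spans only
  `k^⊥`); the dimension count is `finrank_galerkinSpace`.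
* `projPerp 0 i = EuclideanSpace.single i 1` is a harmless junk value (`x / 0 = 0`); the zero
  frequency is excluded from `galerkinIndex`.

## References

* P. Constantin, C. Foias, *Navier–Stokes Equations* (Univ. Chicago Press, 1988), Ch. 4,
  (4.11)–(4.14) (the Stokes operator `A`, its eigenfunctions `w_j` and eigenvalues `λ_j`, the
  projections `P_m`, periodic case).
* R. Temam, *Navier–Stokes Equations. Theory and Numerical Analysis* (North-Holland, 1977),
  Ch. I, §2.6 (the Stokes operator; eigenfunctions in the space-periodic case).
-/

noncomputable section

open MeasureTheory TopologicalSpace Filter UnitAddTorus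
open scoped InnerProductSpace RealInnerProductSpace ENNReal Topology

namespace Literature.Analysis.FluidPDE

namespace Torus

variable {d : Type*} [Fintype d] [DecidableEq d]

/-- Local notation for the real Hilbert space `L²(T^d; ℝ^d)` of square-integrable vector fields
on the flat torus. -/
local notation "L2T" => Lp (EuclideanSpace ℝ d) 2 (volume : Measure (UnitAddTorus d))

/-! ### The Stokes operator as a partially defined operator built from its graph -/

/-- The weak Stokes relation `w = A v = -Δ v` on the torus: for every smooth, divergence-free,
mean-zero field `g` (with `L²` classes `φ` of `g` and `ψ` of `Δ g`),
`⟪w, g⟫_{L²} = -⟪v, Δ g⟫_{L²}` (two integrations by parts, no boundary terms;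
Constantin–Foias 1988, Ch. 4, (4.11)–(4.12); Temam 1977, Ch. I §2.6). [cite: ConstantinFoias1988, Ch. 4  (4.11] -/
def IsStokesImage (v w : L2T) : Prop :=
  ∀ (φ ψ : L2T) (g : UnitAddTorus d → EuclideanSpace ℝ d), FunctionSpaces.Torus.IsSmooth g → FunctionSpaces.Torus.IsDivFree g →
    FunctionSpaces.Torus.HasZeroMean g → ((φ : UnitAddTorus d → EuclideanSpace ℝ d) =ᵐ[volume] g) →
    ((ψ : UnitAddTorus d → EuclideanSpace ℝ d) =ᵐ[volume] fun x => FunctionSpaces.Torus.laplacian g x) →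
    ⟪w, φ⟫_ℝ = -⟪v, ψ⟫_ℝ

/-- `0 = -Δ 0` weakly. [folklore] -/
theorem isStokesImage_zero : IsStokesImage (d := d) 0 0 := by
  intro φ ψ g _ _ _ _ _
  simp [inner_zero_left]

/-- The weak Stokes relation is additive in `(v, w)` (`inner_add_left`). [folklore] -/
theorem IsStokesImage.add {v w v' w' : L2T} (h : IsStokesImage v w) (h' : IsStokesImage v' w') :
    IsStokesImage (v + v') (w + w') := by
  intro φ ψ g hg hdiv hmean hφ hψ
  rw [inner_add_left, inner_add_left, h φ ψ g hg hdiv hmean hφ hψ,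
    h' φ ψ g hg hdiv hmean hφ hψ, neg_add]

/-- The weak Stokes relation is homogeneous in `(v, w)` (`real_inner_smul_left`). [folklore] -/
theorem IsStokesImage.smul {v w : L2T} (r : ℝ) (h : IsStokesImage v w) :
    IsStokesImage (r • v) (r • w) := by
  intro φ ψ g hg hdiv hmean hφ hψ
  rw [real_inner_smul_left, real_inner_smul_left, h φ ψ g hg hdiv hmean hφ hψ, mul_neg]

variable (d) in
/-- The graph of the Stokes operator on `T^d`: pairs `(v, w) ∈ H × H` (`H = Torus.energySpace d`,
mean-zero solenoidal `L²` fields) with `w = -Δ v` weakly (`Torus.IsStokesImage v w`), a submodule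
of `L² × L²` (Constantin–Foias 1988, Ch. 4, (4.11)–(4.12): `D(A) = H ∩ H²`, `A = -P Δ = -Δ` in
the periodic case; Temam 1977, Ch. I §2.6). [cite: ConstantinFoias1988, Ch. 4  (4.11] -/
def stokesGraph : Submodule ℝ (L2T × L2T) where
  carrier := {q | q.1 ∈ FunctionSpaces.Torus.energySpace d ∧ q.2 ∈ FunctionSpaces.Torus.energySpace d ∧ IsStokesImage q.1 q.2}
  zero_mem' := ⟨zero_mem _, zero_mem _, isStokesImage_zero⟩
  add_mem' hp hq := ⟨add_mem hp.1 hq.1, add_mem hp.2.1 hq.2.1, hp.2.2.add hq.2.2⟩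
  smul_mem' r _ hp := ⟨Submodule.smul_mem _ r hp.1, Submodule.smul_mem _ r hp.2.1,
    hp.2.2.smul r⟩

/-- Membership in the Stokes graph, unfolded. [folklore] -/
theorem mem_stokesGraph_iff {q : L2T × L2T} :
    q ∈ stokesGraph d ↔ q.1 ∈ FunctionSpaces.Torus.energySpace d ∧ q.2 ∈ FunctionSpaces.Torus.energySpace d ∧ IsStokesImage q.1 q.2 :=
  Iff.rfl

/-- The Stokes graph is functional (review finding 9): if `(0, w) ∈ stokesGraph d` then
`w = 0`. Indeed `⟪w, g⟫ = -⟪0, Δ g⟫ = 0` for every `g ∈ 𝒱`, so `w ⊥ span 𝒱`, hence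
`w ⊥ closure (span 𝒱) = H` (`Submodule.orthogonal_closure`), and `w ∈ H` forces `w = 0`.
Consequently Mathlib's `Submodule.toLinearPMap` is not in its junk branch on `stokesGraph d`
(Constantin–Foias 1988, Ch. 4: `A` is a well-defined operator on `D(A) ⊂ H`). [cite: ConstantinFoias1988, Ch. 4:  A  is a well-defined operator on] -/
theorem stokesGraph_fst_eq_zero_imp :
    ∀ (q : L2T × L2T) (_hq : q ∈ stokesGraph d) (_hq' : q.fst = 0), q.snd = 0 := by
  rintro ⟨v, w⟩ ⟨-, hw, h⟩ hv
  dsimp only at hv h ⊢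
  subst hv
  -- `w` is orthogonal to `𝒱`
  have h𝒱 : ∀ y ∈ FunctionSpaces.Torus.smoothSolenoidal d, ⟪y, w⟫_ℝ = 0 := by
    rintro y ⟨g, hg, hdiv, hmean, hy⟩
    have hΔ : MemLp (fun x => FunctionSpaces.Torus.laplacian g x) 2 (volume : Measure (UnitAddTorus d)) :=
      hg.laplacian.memLp 2
    have := h y (hΔ.toLp _) g hg hdiv hmean hy (MemLp.coeFn_toLp hΔ)
    rwa [inner_zero_left, neg_zero, real_inner_comm] at this
  -- hence to `span 𝒱`, hence to its closure `H`
  have hspan : ∀ y ∈ Submodule.span ℝ (FunctionSpaces.Torus.smoothSolenoidal d), ⟪y, w⟫_ℝ = 0 := by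
    intro y hy
    induction hy using Submodule.span_induction with
    | mem y hy => exact h𝒱 y hy
    | zero => exact inner_zero_left _
    | add y z _ _ hy hz => rw [inner_add_left, hy, hz, add_zero]
    | smul r y _ hy => rw [real_inner_smul_left, hy, mul_zero]
  have hH : w ∈ (FunctionSpaces.Torus.energySpace d)ᗮ := by
    unfold FunctionSpaces.Torus.energySpace
    rw [Submodule.orthogonal_closure, Submodule.mem_orthogonal]
    exact hspan
  exact inner_self_eq_zero.mp (Submodule.inner_right_of_mem_orthogonal hw hH)

variable (d) in
/-- The Stokes operator `A` on the flat torus `T^d`, as a partially defined linear operator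
on `L²(T^d; ℝ^d)` with domain `D(A) = H ∩ H²` and `A v = -P Δ v = -Δ v`, defined from its graph
`Torus.stokesGraph d` via Mathlib's `Submodule.toLinearPMap` (well defined by
`stokesGraph_fst_eq_zero_imp`) (Constantin–Foias 1988, Ch. 4, (4.11)–(4.12); Temam 1977, Ch. I
§2.6). Its diagonal (Fourier) description is `stokesOperator_eq_diagonalPMap`. [cite: ConstantinFoias1988, Ch. 4  (4.11] -/
def stokesOperator : L2T →ₗ.[ℝ] L2T :=
  (stokesGraph d).toLinearPMap

/-- The graph of the Stokes operator is `stokesGraph d` (Mathlib's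
`Submodule.toLinearPMap_graph_eq`, applicable thanks to `stokesGraph_fst_eq_zero_imp`). [folklore] -/
theorem graph_stokesOperator : (stokesOperator d).graph = stokesGraph d :=
  Submodule.toLinearPMap_graph_eq _ stokesGraph_fst_eq_zero_imp

omit [DecidableEq d] in
/-- The Stokes eigenvalue attached to the frequency `k ∈ ℤ^d`: `λ_k = 4π²|k|²`
(`-Δ e^{2πi k·x} = 4π²|k|² e^{2πi k·x}`; Constantin–Foias 1988, Ch. 4, (4.13)–(4.14); Temam
1977, Ch. I §2.6). [cite: ConstantinFoias1988, Ch. 4  (4.13] -/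
def stokesEigenvalue (k : d → ℤ) : ℝ :=
  4 * Real.pi ^ 2 * FunctionSpaces.Torus.freqNormSq k

omit [DecidableEq d] in
/-- Stokes eigenvalues are non-negative. [folklore] -/
theorem stokesEigenvalue_nonneg (k : d → ℤ) : 0 ≤ stokesEigenvalue k := by
  unfold stokesEigenvalue
  have := FunctionSpaces.Torus.freqNormSq_nonneg k
  positivity

/-! ### Domain, self-adjointness, positivity -/

/-- Domain of the Stokes operator: `D(A) = H ∩ H²(T^d; ℝ^d)`, the real field being
complexified componentwise for the spectral Sobolev predicate `Torus.MemSobolev 2`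
(Constantin–Foias 1988, Ch. 4, (4.11); Temam 1977, Ch. I §2.6). [cite: ConstantinFoias1988, Ch. 4  (4.11] -/
def stokesOperator_domain_eq : Prop :=
  ((stokesOperator d).domain : Set L2T) =
      (FunctionSpaces.Torus.energySpace d : Set L2T) ∩
        {v | FunctionSpaces.Torus.MemSobolev 2
          (FunctionSpaces.EuclideanSpace.complexify ∘ (v : UnitAddTorus d → EuclideanSpace ℝ d))}

/-- Membership in the domain of the Stokes operator: `v ∈ D(A) ↔ v ∈ H ∧ v ∈ H²`
(Constantin–Foias 1988, Ch. 4, (4.11)). [cite: ConstantinFoias1988, Ch. 4  (4.11] -/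
def mem_domain_stokesOperator_iff : Prop :=
  ∀ (v : L2T),
    v ∈ (stokesOperator d).domain ↔
      v ∈ FunctionSpaces.Torus.energySpace d ∧
        FunctionSpaces.Torus.MemSobolev 2 (FunctionSpaces.EuclideanSpace.complexify ∘ (v : UnitAddTorus d → EuclideanSpace ℝ d))

/- interim proof relied on results that are now named facts (D-0014); demoted to a fact by the D-0014 sorry-sweep, proof preserved:
:= by
  have h := congrArg (v ∈ ·) (stokesOperator_domain_eq (d := d))
  simpa using h
-/

/-- The domain of the Stokes operator is contained in `H`. [folklore] -/
theorem domain_stokesOperator_le_energySpace : (stokesOperator d).domain ≤ FunctionSpaces.Torus.energySpace d := by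
  rintro v ⟨q, hq, rfl⟩
  exact hq.1

/-- The Stokes operator is positive: symmetric with `⟪v, A v⟫ = ‖∇v‖² ≥ 0` on `D(A)`
(H21 `LinearPMap.IsPositive`; Constantin–Foias 1988, Ch. 4, (4.12); Temam 1977, Ch. I §2.6). [cite: ConstantinFoias1988, Ch. 4  (4.12] -/
def isPositive_stokesOperator : Prop :=
  (stokesOperator d).IsPositive

/-! ### The Stokes operator as an operator in the Hilbert space `H` -/

variable (d) in
/-- The graph of the Stokes operator viewed inside `H × H` (`H = Torus.energySpace d` as a
Hilbert space in its own right): pairs `(v, w)` of elements of `H` with `w = -Δ v` weakly. This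
is the pull-back of `Torus.stokesGraph d` along the inclusion `H × H → L² × L²`
(Constantin–Foias 1988, Ch. 4, (4.11)–(4.12): `A` is an operator *in `H`*). [cite: ConstantinFoias1988, Ch. 4  (4.11] -/
def stokesGraphH : Submodule ℝ (FunctionSpaces.Torus.energySpace d × FunctionSpaces.Torus.energySpace d) where
  carrier := {q | IsStokesImage (q.1 : L2T) (q.2 : L2T)}
  zero_mem' := isStokesImage_zero
  add_mem' hp hq := hp.add hq
  smul_mem' r _ hp := hp.smul r

/-- Membership in `stokesGraphH d` is membership of the underlying `L²` pair in
`stokesGraph d`. [folklore] -/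
theorem mem_stokesGraphH_iff {q : FunctionSpaces.Torus.energySpace d × FunctionSpaces.Torus.energySpace d} :
    q ∈ stokesGraphH d ↔ ((q.1 : L2T), (q.2 : L2T)) ∈ stokesGraph d :=
  ⟨fun h => ⟨q.1.2, q.2.2, h⟩, fun h => h.2.2⟩

/-- The graph `stokesGraphH d ⊂ H × H` is functional (immediate from
`stokesGraph_fst_eq_zero_imp`). [folklore] -/
theorem stokesGraphH_fst_eq_zero_imp :
    ∀ (q : FunctionSpaces.Torus.energySpace d × FunctionSpaces.Torus.energySpace d) (_hq : q ∈ stokesGraphH d) (_hq' : q.fst = 0),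
      q.snd = 0 := by
  intro q hq hq'
  have h := stokesGraph_fst_eq_zero_imp (d := d) ((q.1 : L2T), (q.2 : L2T))
    (mem_stokesGraphH_iff.mp hq) (by simp [hq'])
  exact Subtype.ext h

variable (d) in
/-- The Stokes operator `A` as a partially defined operator *in the Hilbert space*
`H = Torus.energySpace d` (with the `CompleteSpace` instance of
`Literature.Prelude.FluidKinetic.LerayProjector`), `D(A) = H ∩ H²`, `A v = -Δ v`; this is the version
for which self-adjointness is meaningful (a self-adjoint `LinearPMap` has dense domain, Mathlib's
`IsSelfAdjoint.dense_domain`, and `D(A)` is dense in `H` but not in `L²`). It agrees with the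
`L²`-valued `Torus.stokesOperator d` (`coe_stokesOperatorH_apply`) (Constantin–Foias 1988,
Ch. 4, (4.11)–(4.12); Temam 1977, Ch. I §2.6). [cite: ConstantinFoias1988, Ch. 4  (4.11] -/
def stokesOperatorH : FunctionSpaces.Torus.energySpace d →ₗ.[ℝ] FunctionSpaces.Torus.energySpace d :=
  (stokesGraphH d).toLinearPMap

/-- The graph of `stokesOperatorH d` is `stokesGraphH d`. [folklore] -/
theorem graph_stokesOperatorH : (stokesOperatorH d).graph = stokesGraphH d :=
  Submodule.toLinearPMap_graph_eq _ stokesGraphH_fst_eq_zero_imp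

/-- The two versions of the Stokes operator have the same domain: `v ∈ D(A_H) ↔ ↑v ∈ D(A)`. [folklore] -/
theorem mem_domain_stokesOperatorH_iff (v : FunctionSpaces.Torus.energySpace d) :
    v ∈ (stokesOperatorH d).domain ↔ (v : L2T) ∈ (stokesOperator d).domain := by
  simp only [stokesOperatorH, stokesOperator, Submodule.toLinearPMap_domain, Submodule.mem_map,
    LinearMap.fst_apply, Prod.exists, exists_and_right, exists_eq_right]
  constructor
  · rintro ⟨w, hw⟩
    exact ⟨(w : L2T), mem_stokesGraphH_iff.mp hw⟩
  · rintro ⟨w, hw⟩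
    exact ⟨⟨w, hw.2.1⟩, mem_stokesGraphH_iff.mpr hw⟩

/-- The two versions of the Stokes operator agree: `↑(A_H v) = A ↑v` in `L²`. [folklore] -/
theorem coe_stokesOperatorH_apply (v : (stokesOperatorH d).domain) :
    ((stokesOperatorH d v : FunctionSpaces.Torus.energySpace d) : L2T) =
      stokesOperator d ⟨(v : FunctionSpaces.Torus.energySpace d), (mem_domain_stokesOperatorH_iff _).mp v.2⟩ := by
  have h₁ : (((v : FunctionSpaces.Torus.energySpace d) : L2T), ((stokesOperatorH d v : FunctionSpaces.Torus.energySpace d) : L2T)) ∈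
      stokesGraph d :=
    mem_stokesGraphH_iff.mp (Submodule.mem_graph_toLinearPMap stokesGraphH_fst_eq_zero_imp v)
  have h₂ : (((v : FunctionSpaces.Torus.energySpace d) : L2T),
      stokesOperator d ⟨(v : FunctionSpaces.Torus.energySpace d), (mem_domain_stokesOperatorH_iff _).mp v.2⟩) ∈
      stokesGraph d :=
    Submodule.mem_graph_toLinearPMap stokesGraph_fst_eq_zero_imp
      ⟨_, (mem_domain_stokesOperatorH_iff _).mp v.2⟩
  have h := stokesGraph_fst_eq_zero_imp (d := d) _ (sub_mem h₁ h₂) (sub_self _)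
  exact sub_eq_zero.mp h

/-- The Stokes operator is self-adjoint in `H` (`A† = A` for Mathlib's `LinearPMap.adjoint`
on the Hilbert space `H = Torus.energySpace d`; Constantin–Foias 1988, Ch. 4, after (4.12);
Temam 1977, Ch. I §2.6). The corresponding statement for the `L²`-valued `stokesOperator d` is
false (its domain is not dense in `L²`), which is why it is stated for `stokesOperatorH d`. [cite: ConstantinFoias1988, Ch. 4  after (4.12] -/
def isSelfAdjoint_stokesOperatorH : Prop :=
  IsSelfAdjoint (stokesOperatorH d)

/-- The Stokes operator in `H` is positive (H21 `LinearPMap.IsPositive`; Constantin–Foias 1988,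
Ch. 4, (4.12)). [cite: ConstantinFoias1988, Ch. 4  (4.12] -/
def isPositive_stokesOperatorH : Prop :=
  (stokesOperatorH d).IsPositive

/-! ### Eigenfields -/

omit [DecidableEq d] in
/-- The real Stokes eigenfield with frequency `k ∈ ℤ^d`, amplitude `a ∈ ℝ^d` and phase `c`:
`x ↦ cos(2π k·x) a` for `c = true` and `x ↦ sin(2π k·x) a` for `c = false` (real and imaginary
parts of Mathlib's Fourier monomial `UnitAddTorus.mFourier k`), as a continuous map; it is
solenoidal iff `k · a = 0` (Constantin–Foias 1988, Ch. 4, (4.13)–(4.14); Temam 1977, Ch. I §2.6). [cite: ConstantinFoias1988, Ch. 4  (4.13] -/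
def stokesMode (k : d → ℤ) (a : EuclideanSpace ℝ d) (c : Bool) :
    C(UnitAddTorus d, EuclideanSpace ℝ d) where
  toFun x := (if c then (mFourier k x).re else (mFourier k x).im) • a
  continuous_toFun := by
    cases c
    · exact (Complex.continuous_im.comp (mFourier k).continuous).smul continuous_const
    · exact (Complex.continuous_re.comp (mFourier k).continuous).smul continuous_const

omit [DecidableEq d] in
/-- Unfolding `stokesMode`. [folklore] -/
theorem stokesMode_apply (k : d → ℤ) (a : EuclideanSpace ℝ d) (c : Bool) (x : UnitAddTorus d) :
    stokesMode k a c x = (if c then (mFourier k x).re else (mFourier k x).im) • a :=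
  rfl

omit [DecidableEq d] in
/-- The Stokes eigenfield `stokesMode k a c` as an element of `L²(T^d; ℝ^d)` (Mathlib's
`ContinuousMap.toLp` on the compact probability space `T^d`) (Constantin–Foias 1988, Ch. 4,
(4.13)). [cite: ConstantinFoias1988, Ch. 4  (4.13] -/
def stokesModeL2 (k : d → ℤ) (a : EuclideanSpace ℝ d) (c : Bool) : L2T :=
  ContinuousMap.toLp (E := EuclideanSpace ℝ d) 2 volume ℝ (stokesMode k a c)

omit [DecidableEq d] in
/-- `stokesModeL2 k a c` is represented by `stokesMode k a c`. [folklore] -/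
theorem coeFn_stokesModeL2 (k : d → ℤ) (a : EuclideanSpace ℝ d) (c : Bool) :
    (stokesModeL2 k a c : UnitAddTorus d → EuclideanSpace ℝ d) =ᵐ[volume] stokesMode k a c :=
  ContinuousMap.coeFn_toLp (E := EuclideanSpace ℝ d) volume _

/-- Stokes eigenfields: for `k ≠ 0`, `a ≠ 0` with `k · a = 0`, the field
`cos(2π k·x) a` / `sin(2π k·x) a` is an eigenvector of the Stokes operator with eigenvalue
`4π²|k|²` (H21 `LinearPMap.HasEigenvector`; Constantin–Foias 1988, Ch. 4, (4.13)–(4.14); Temam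
1977, Ch. I §2.6). [cite: ConstantinFoias1988, Ch. 4  (4.13] -/
def hasEigenvector_stokesOperator_stokesModeL2 : Prop :=
  ∀ {k : d → ℤ} {a : EuclideanSpace ℝ d} (hk : k ≠ 0) (ha : a ≠ 0) (hka : ⟪FunctionSpaces.Torus.latticeVec k, a⟫_ℝ = 0) (c : Bool),
    (stokesOperator d).HasEigenvector (stokesEigenvalue k) (stokesModeL2 k a c)

/-- The Stokes operator is diagonal in any basis of Stokes modes (bridge to the UnbddOp trunk,
review finding 9c): if `b` is a Hilbert basis of `H = Torus.energySpace d` each of whose vectors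
is a Stokes mode `stokesModeL2 k a c`, and `m i = 4π²|k|²` is the corresponding eigenvalue, then
the graph-defined Stokes operator in `H` *equals* the maximal diagonal operator
`b.diagonalPMap m` (`Literature.Prelude.UnbddOp.DiagonalOperator`), domains included:
`A v = ∑ᵢ m i ⟪b i, v⟫ b i` (Constantin–Foias 1988, Ch. 4, (4.13)–(4.14): `A` has compact
inverse and `{w_j}` is an orthonormal basis of `H` of eigenfunctions; Temam 1977, Ch. I §2.6). [cite: ConstantinFoias1988, Ch. 4  (4.13] -/
def stokesOperatorH_eq_diagonalPMap : Prop :=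
  ∀ {ι : Type*} (b : HilbertBasis ι ℝ (FunctionSpaces.Torus.energySpace d)) (m : ι → ℝ) (hb : ∀ i, ∃ (k : d → ℤ) (a : EuclideanSpace ℝ d) (c : Bool), ((b i : FunctionSpaces.Torus.energySpace d) : L2T) = stokesModeL2 k a c ∧ m i = stokesEigenvalue k),
    stokesOperatorH d = b.diagonalPMap m

/-- Corollary of `stokesOperatorH_eq_diagonalPMap` for the `L²`-valued operator: for any Hilbert
basis `b` of `H` made of Stokes modes with symbol `m = stokesEigenvalue`, `stokesOperator d` and
`b.diagonalPMap m` have the same domain inside `H` and agree on it (Constantin–Foias 1988, Ch. 4,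
(4.13)–(4.14)). [cite: ConstantinFoias1988, Ch. 4  (4.13] -/
def stokesOperator_eq_diagonalPMap : Prop :=
  ∀ {ι : Type*} (b : HilbertBasis ι ℝ (FunctionSpaces.Torus.energySpace d)) (m : ι → ℝ) (hb : ∀ i, ∃ (k : d → ℤ) (a : EuclideanSpace ℝ d) (c : Bool), ((b i : FunctionSpaces.Torus.energySpace d) : L2T) = stokesModeL2 k a c ∧ m i = stokesEigenvalue k) (v : FunctionSpaces.Torus.energySpace d),
    ((v : L2T) ∈ (stokesOperator d).domain ↔ v ∈ b.diagonalDomain m) ∧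
      ∀ (hv : (v : L2T) ∈ (stokesOperator d).domain) (hv' : v ∈ b.diagonalDomain m),
        stokesOperator d ⟨v, hv⟩ = ((b.diagonalPMap m ⟨v, hv'⟩ : FunctionSpaces.Torus.energySpace d) : L2T)

/- interim proof relied on results that are now named facts (D-0014); demoted to a fact by the D-0014 sorry-sweep, proof preserved:
:= by
  have hAB := stokesOperatorH_eq_diagonalPMap b m hb
  obtain ⟨hdom, happ⟩ := LinearPMap.ext_iff.mp hAB
  have hmem : (v : L2T) ∈ (stokesOperator d).domain ↔ v ∈ b.diagonalDomain m := by
    rw [← mem_domain_stokesOperatorH_iff, hdom]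
    rfl
  refine ⟨hmem, fun hv hv' => ?_⟩
  have hvH : v ∈ (stokesOperatorH d).domain := (mem_domain_stokesOperatorH_iff v).mpr hv
  have h := coe_stokesOperatorH_apply (d := d) ⟨v, hvH⟩
  have h' : stokesOperatorH d ⟨v, hvH⟩ = b.diagonalPMap m ⟨v, hv'⟩ := @happ v hvH hv'
  rw [← h', h]
-/

/-! ### Galerkin truncations -/

omit [DecidableEq d] in
/-- The Galerkin frequency set of order `N`: the non-zero frequencies `k ∈ ℤ^d` with
`|k|² ≤ N²` (Constantin–Foias 1988, Ch. 4, (4.14): the first eigenvalues `λ_j ≤ 4π²N²`). It is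
carved out of the box `[-N, N]^d` only as a finiteness device: the box condition is implied by
`|k|² ≤ N²` (`mem_galerkinIndex_iff'`). [cite: ConstantinFoias1988, Ch. 4  (4.14] -/
def galerkinIndex (N : ℕ) : Finset (d → ℤ) :=
  (Fintype.piFinset fun _ : d => Finset.Icc (-(N : ℤ)) N).filter
    fun k => FunctionSpaces.Torus.freqNormSq k ≤ (N : ℝ) ^ 2 ∧ k ≠ 0

/-- Membership in the Galerkin frequency set, with the (redundant) box condition. [folklore] -/
theorem mem_galerkinIndex_iff {N : ℕ} {k : d → ℤ} :
    k ∈ galerkinIndex N ↔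
      (∀ i, k i ∈ Finset.Icc (-(N : ℤ)) N) ∧ FunctionSpaces.Torus.freqNormSq k ≤ (N : ℝ) ^ 2 ∧ k ≠ 0 := by
  simp only [galerkinIndex, Finset.mem_filter, Fintype.mem_piFinset]

omit [DecidableEq d] in
/-- Each coordinate is bounded by the frequency norm: `(k i)² ≤ |k|²`. [folklore] -/
theorem sq_apply_le_freqNormSq (k : d → ℤ) (i : d) : ((k i : ℝ)) ^ 2 ≤ FunctionSpaces.Torus.freqNormSq k := by
  unfold FunctionSpaces.Torus.freqNormSq
  exact Finset.single_le_sum (f := fun j => ((k j : ℝ)) ^ 2) (fun j _ => sq_nonneg _)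
    (Finset.mem_univ i)

/-- Membership in the Galerkin frequency set without the box condition:
`k ∈ galerkinIndex N ↔ |k|² ≤ N² ∧ k ≠ 0` (the box `[-N, N]^d` is automatic since
`(k i)² ≤ |k|² ≤ N²`). [folklore] -/
theorem mem_galerkinIndex_iff' {N : ℕ} {k : d → ℤ} :
    k ∈ galerkinIndex N ↔ FunctionSpaces.Torus.freqNormSq k ≤ (N : ℝ) ^ 2 ∧ k ≠ 0 := by
  rw [mem_galerkinIndex_iff]
  refine ⟨fun h => h.2, fun h => ⟨fun i => ?_, h⟩⟩
  have hi : ((k i : ℝ)) ^ 2 ≤ (N : ℝ) ^ 2 := (sq_apply_le_freqNormSq k i).trans h.1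
  have habs : -(N : ℝ) ≤ (k i : ℝ) ∧ (k i : ℝ) ≤ N := abs_le_of_sq_le_sq' hi (Nat.cast_nonneg N)
  simp only [Finset.mem_Icc]
  exact ⟨by exact_mod_cast habs.1, by exact_mod_cast habs.2⟩

/-- The Galerkin frequency set is symmetric under `k ↦ -k` (used in the dimension count
`finrank_galerkinSpace`: the modes of `k` and `-k` coincide up to sign). [folklore] -/
theorem neg_mem_galerkinIndex {N : ℕ} {k : d → ℤ} (hk : k ∈ galerkinIndex N) :
    -k ∈ galerkinIndex N := by
  rw [mem_galerkinIndex_iff'] at hk ⊢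
  refine ⟨?_, neg_ne_zero.mpr hk.2⟩
  have : FunctionSpaces.Torus.freqNormSq (-k) = FunctionSpaces.Torus.freqNormSq k := by simp [FunctionSpaces.Torus.freqNormSq]
  rw [this]
  exact hk.1

/-- The `i`-th standard basis vector projected orthogonally onto `k^⊥`:
`eᵢ − (kᵢ / |k|²) k`; as `i` ranges over `d` these span the amplitudes `a ⊥ k` of the Stokes
modes of frequency `k` (Constantin–Foias 1988, Ch. 4, (4.13)). Junk value at `k = 0`
(`x / 0 = 0`): `projPerp 0 i = eᵢ`; the zero frequency is excluded from `galerkinIndex`. [cite: ConstantinFoias1988, Ch. 4  (4.13] -/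
def projPerp (k : d → ℤ) (i : d) : EuclideanSpace ℝ d :=
  EuclideanSpace.single i 1 - ((k i : ℝ) / FunctionSpaces.Torus.freqNormSq k) • FunctionSpaces.Torus.latticeVec k

/-- `projPerp k i ⊥ k`: `⟪k, eᵢ − (kᵢ/|k|²) k⟫ = kᵢ − kᵢ = 0` (for `k ≠ 0`). [folklore] -/
theorem inner_latticeVec_projPerp {k : d → ℤ} (hk : k ≠ 0) (i : d) :
    ⟪FunctionSpaces.Torus.latticeVec k, projPerp k i⟫_ℝ = 0 := by
  have hne : FunctionSpaces.Torus.freqNormSq k ≠ 0 := by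
    intro h0
    apply hk
    funext j
    have hj := (Finset.sum_eq_zero_iff_of_nonneg fun j _ => sq_nonneg (k j : ℝ)).mp h0 j
      (Finset.mem_univ j)
    exact_mod_cast (pow_eq_zero_iff two_ne_zero).mp hj
  have hkk : ⟪FunctionSpaces.Torus.latticeVec k, FunctionSpaces.Torus.latticeVec k⟫_ℝ = FunctionSpaces.Torus.freqNormSq k := by
    rw [real_inner_self_eq_norm_sq, EuclideanSpace.real_norm_sq_eq]
    simp [FunctionSpaces.Torus.freqNormSq]
  rw [projPerp, inner_sub_right, real_inner_smul_right, hkk, EuclideanSpace.inner_single_right,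
    div_mul_cancel₀ _ hne]
  simp

/-- The Galerkin family of order `N`: the Stokes modes `stokesModeL2 k (projPerp k i) c` for
`k ∈ galerkinIndex N`, `i : d`, `c : Bool`, indexed by a `Fintype` (Constantin–Foias 1988,
Ch. 4, (4.13)–(4.14): the eigenfunctions `w_j` with `λ_j ≤ 4π²N²`). The family is redundant
(`±k`, and `projPerp k ·` spans only `k^⊥`), which is harmless for the span. [cite: ConstantinFoias1988, Ch. 4  (4.13] -/
def galerkinFamily (N : ℕ) : ↥(galerkinIndex (d := d) N) × d × Bool → L2T :=
  fun p => stokesModeL2 (p.1 : d → ℤ) (projPerp (p.1 : d → ℤ) p.2.1) p.2.2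

/-- The Galerkin space of order `N`: the (finite-dimensional) span in `L²(T^d; ℝ^d)` of the
Stokes modes with frequencies in `galerkinIndex N`, i.e. `span {w_j | λ_j ≤ 4π²N²}` = the range
of `P_N` (Constantin–Foias 1988, Ch. 4, (4.14); Temam 1977, Ch. I §2.6 / Ch. III §3). [cite: ConstantinFoias1988, Ch. 4  (4.14] -/
def galerkinSpace (N : ℕ) : Submodule ℝ L2T :=
  Submodule.span ℝ (Set.range (galerkinFamily (d := d) N))

/-- The Galerkin space is finite-dimensional (span of a finite family;
`FiniteDimensional.span_of_finite`). [folklore] -/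
instance instFiniteDimensionalGalerkinSpace (N : ℕ) :
    FiniteDimensional ℝ (galerkinSpace (d := d) N) :=
  FiniteDimensional.span_of_finite ℝ (Set.finite_range _)

/-- The Galerkin space is complete (finite-dimensional; `FiniteDimensional.complete`), so that
Mathlib's `Submodule.HasOrthogonalProjection.ofCompleteSpace` provides its orthogonal
projection. [folklore] -/
instance instCompleteSpaceGalerkinSpace (N : ℕ) : CompleteSpace (galerkinSpace (d := d) N) :=
  FiniteDimensional.complete ℝ _

/-- The Galerkin projection `P_N : L²(T^d; ℝ^d) → L²`, the orthogonal projection onto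
`galerkinSpace N` (Mathlib's `Submodule.starProjection`) (Constantin–Foias 1988, Ch. 4, (4.14):
`P_m u = ∑_{j ≤ m} (u, w_j) w_j`; Temam 1977, Ch. III §3, Galerkin method). [cite: ConstantinFoias1988, Ch. 4  (4.14] -/
def galerkinProj (N : ℕ) : L2T →L[ℝ] L2T :=
  (galerkinSpace (d := d) N).starProjection

/-- The Galerkin spaces consist of smooth solenoidal mean-zero fields: `galerkinSpace N ≤ H`
(Constantin–Foias 1988, Ch. 4, (4.13)). [cite: ConstantinFoias1988, Ch. 4  (4.13] -/
def galerkinSpace_le_energySpace : Prop :=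
  ∀ (N : ℕ),
    galerkinSpace (d := d) N ≤ FunctionSpaces.Torus.energySpace d

/-- The Galerkin spaces increase with `N`. [folklore] -/
theorem galerkinSpace_mono : Monotone (galerkinSpace (d := d)) := by
  intro N M hNM
  refine Submodule.span_mono ?_
  rintro _ ⟨⟨⟨k, hk⟩, i, c⟩, rfl⟩
  have hk' : k ∈ galerkinIndex M := by
    rw [mem_galerkinIndex_iff] at hk ⊢
    refine ⟨fun j => ?_, hk.2.1.trans ?_, hk.2.2⟩
    · have := hk.1 j
      simp only [Finset.mem_Icc] at this ⊢
      omega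
    · have : (N : ℝ) ≤ M := by exact_mod_cast hNM
      gcongr
  exact ⟨⟨⟨k, hk'⟩, i, c⟩, rfl⟩

/-- Dimension of the Galerkin space: `dim galerkinSpace N = #(galerkinIndex N) · (d − 1)`
(each pair `±k` contributes the `2(d−1)` independent modes `cos(2πk·x) a`, `sin(2πk·x) a`,
`a ∈ k^⊥`; Constantin–Foias 1988, Ch. 4, (4.13)–(4.14)). The `ℕ`-subtraction is harmless: for
empty `d` both sides vanish. [cite: ConstantinFoias1988, Ch. 4  (4.13] -/
def finrank_galerkinSpace : Prop :=
  ∀ (N : ℕ),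
    Module.finrank ℝ (galerkinSpace (d := d) N) =
      (galerkinIndex (d := d) N).card * (Fintype.card d - 1)

/-- `P_N` is the identity on `galerkinSpace N` (Mathlib's `Submodule.starProjection_eq_self_iff`). [folklore] -/
theorem galerkinProj_eq_self_of_mem {N : ℕ} {v : L2T} (hv : v ∈ galerkinSpace (d := d) N) :
    galerkinProj N v = v :=
  Submodule.starProjection_eq_self_iff.mpr hv

/-- `P_N v ∈ galerkinSpace N`. [folklore] -/
theorem galerkinProj_apply_mem (N : ℕ) (v : L2T) :
    galerkinProj (d := d) N v ∈ galerkinSpace (d := d) N :=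
  Submodule.starProjection_apply_mem _ v

/-- `P_N` is an orthogonal projection (`P_N² = P_N = P_N*`; Mathlib's
`isStarProjection_starProjection`). [folklore] -/
theorem isStarProjection_galerkinProj (N : ℕ) : IsStarProjection (galerkinProj (d := d) N) :=
  isStarProjection_starProjection

/-- `P_N P = P_N`: the Galerkin projection factors through the Leray projector, since
`galerkinSpace N ≤ H` (Constantin–Foias 1988, Ch. 4, (4.14)). [cite: ConstantinFoias1988, Ch. 4  (4.14] -/
def galerkinProj_comp_lerayProjector : Prop :=
  ∀ (N : ℕ),
    (galerkinProj (d := d) N).comp (lerayProjector d) = galerkinProj N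

/-- `P_N` maps `D(A)` into itself (indeed into `galerkinSpace N ⊂ D(A)`, a span of finitely
many eigenfunctions of `A`; Constantin–Foias 1988, Ch. 4, (4.14)). [cite: ConstantinFoias1988, Ch. 4  (4.14] -/
def galerkinProj_mem_domain_stokesOperator : Prop :=
  ∀ (N : ℕ) (v : L2T),
    galerkinProj (d := d) N v ∈ (stokesOperator d).domain

/-- The Galerkin projections commute with the Stokes operator: `A (P_N v) = P_N (A v)` for
`v ∈ D(A)` (`P_N` is the spectral projection of `A` onto the span of its first eigenfunctions;
Constantin–Foias 1988, Ch. 4, (4.14); Temam 1977, Ch. III §3). This is the outline's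
`galerkinProj_commute_stokes`; the membership `P_N v ∈ D(A)` is the named fact
`galerkinProj_mem_domain_stokesOperator`, taken as the hypothesis `hmem` (D-0014). [cite: ConstantinFoias1988, Ch. 4  (4.14] -/
def stokesOperator_galerkinProj : Prop :=
  ∀ (hmem : galerkinProj_mem_domain_stokesOperator (d := d)) (N : ℕ) (v : (stokesOperator d).domain),
    stokesOperator d ⟨galerkinProj N (v : L2T), hmem N _⟩ =
      galerkinProj N (stokesOperator d v)

/-- Convergence of the Galerkin projections: `P_N v → v` in `L²` as `N → ∞` for every
`v ∈ H` (completeness of the Stokes eigenfunctions in `H`; Constantin–Foias 1988, Ch. 4,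
(4.13)–(4.14); Temam 1977, Ch. I §2.6). [cite: ConstantinFoias1988, Ch. 4  (4.13] -/
def tendsto_galerkinProj : Prop :=
  ∀ {v : L2T} (hv : v ∈ FunctionSpaces.Torus.energySpace d),
    Tendsto (fun N => galerkinProj (d := d) N v) atTop (𝓝 v)

/-- The Galerkin spaces exhaust `H`: the `L²` closure of `⋃_N galerkinSpace N` is the energy
space `H` (the Stokes eigenfunctions form an orthonormal basis of `H`; Constantin–Foias 1988,
Ch. 4, (4.13); Temam 1977, Ch. I §2.6). [cite: ConstantinFoias1988, Ch. 4  (4.13] -/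
def topologicalClosure_iSup_galerkinSpace : Prop :=
  (⨆ N, galerkinSpace (d := d) N).topologicalClosure = FunctionSpaces.Torus.energySpace d

end Torus

end Literature.Analysis.FluidPDE
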